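import Summits.ResolutionOfSingularities.ResolutionOfSingularities.Theorems.HilbertSamuelEliminationSigmaMaxModificationsCorridor3SigmaRowRunPFrame

/-!
# `SigmaMaxModificationsCorridor3` — negative lemmas: the ENGINE-I row-P incidence laws are refutable when
# quantified over ALL `RowRunP.RowState`s (they must be relativised to a Reach-closed class of good states)

[OURS · L1 W4.2 · seat res-L1-w42-tri-2 (triager 2), row §R18-FRAME-A (B-1); support (negative) lemmas for
`stmt-ResolutionOfSingularities-19249` / crux `stmt-ResolutionOfSingularities-18506`, filed `--supports`; this file
declares no Theses conclusion, positively or negatively.]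

The (51a-F) instance file `…Corridor3SigmaRowRunPFrame` (p574402) reads `η`, `E⁻` and the double curves off an
ARBITRARY `RowState` (any locally Noetherian scheme `W`, any list `E : Sigma.Boundary W` of ideal sheaves, any split
`ℓ₀ ≤ |E|`). Two of the named transport laws that the sequel assembles into `PIncidence.GuardedLaws` —
«`η ≤ 3` everywhere» and «every member of `E⁻` is non-empty as a point set» — are FALSE when quantified over all
states, so any theorem taking them as hypotheses in that unrelativised form is vacuous; witnesses on `Spec ℤ`:
`E = [⊥, ⊥, ⊥, ⊥]`, `ℓ₀ = 4` gives `η = 4` at the generic point (`not_eta_le_three_all`), and `E = [⊤]`, `ℓ₀ = 1`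
gives the empty member (`not_Eminus_nonempty_all`). The second also bites the instance's own run: class (A4) blows
up a whole `E⁻` member `F ⊆ T` (Cutkosky 2009, Thm 7.2 proof, p. 21 l. 39–41), `F` is Cartier, and its strict
transform is `⊤`, which stays among the first `ℓ₀` members of `E.next`. Repair (not in this file): state the laws
over a Reach-closed predicate `Good` (regular threefold stage, snc boundary without empty old members, …) and build
the frame on `{s // Good s}`. Universe fixed to `0` (`Spec ℤ`; the witnesses are built inside the proofs, no definitions); NOT a statement of the manuscript under review. [folklore]
-/

set_option linter.dupNamespace false

namespace Summit.ResolutionOfSingularities.ResolutionOfSingularities.Theorems.SigmaMaxModifications.Negative.RowStateLawsUnrelativised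

open AlgebraicGeometry CategoryTheory
open Summit.ResolutionOfSingularities.ResolutionOfSingularities.Theorems.SigmaMaxModificationsCorridor3
open Summit.ResolutionOfSingularities.ResolutionOfSingularities.Theorems.SigmaMaxModificationsCorridor3.RowRunP

/-- Filtering by an everywhere-true predicate keeps the length (instance-polymorphic in the decidability
witnesses, so that it applies to the `filter` inside `Sigma.membersThrough`). [folklore] -/
theorem length_filter_of_forall {α : Type*} (l : List α) (p : α → Prop) (d : ∀ a, Decidable (p a))
    (h : ∀ a ∈ l, p a) : (l.filter fun a => @decide (p a) (d a)).length = l.length := by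
  rw [List.filter_eq_self.2 (fun a ha => by simpa using h a ha)]

/-- **The law «`η ≤ 3` at every point of every state» is false over all `RowState`s**: on `Spec ℤ` with
`E = [⊥, ⊥, ⊥, ⊥]`, `ℓ₀ = 4`, all four old members pass through the generic point, `η = 4`. Hence the law can only be
a hypothesis about a restricted (Reach-closed) class of states. [folklore] -/
theorem not_eta_le_three_all : ¬ (∀ (s : RowState.{0}) (x : ULift.{1} s.W), s.eta x ≤ 3) := by
  intro h
  let s4 : RowState.{0} :=
    { W := Spec (CommRingCat.of ℤ), ln := inferInstance, I := ⊤, N := ⊤, E := [⊥, ⊥, ⊥, ⊥], ℓ₀ := 4,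
      ℓ₀_le := le_rfl, after9 := False }
  let x0 : s4.W := (⟨⊥, Ideal.isPrime_bot⟩ : PrimeSpectrum ℤ)
  have hmem : ∀ I ∈ (s4.E.take 4), x0 ∈ (I.support : Set s4.W) := by
    intro I hI
    have hI' : I = ⊥ := List.eq_of_mem_replicate (n := 4) hI
    subst hI'
    simp only [Scheme.IdealSheafData.support_bot, TopologicalSpace.Closeds.coe_top, Set.mem_univ]
  have h4 : (s4.E.take 4).length = 4 := rfl
  have key : s4.eta ⟨x0⟩ = 4 := by
    unfold RowState.eta Sigma.membersThrough RowState.Eminus Sigma.Boundary.epochMinus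
    exact (length_filter_of_forall (s4.E.take 4) _ _ hmem).trans h4
  have := h s4 ⟨x0⟩
  rw [key] at this
  omega

/-- **The law «every member of `E⁻` is non-empty as a point set» is false over all `RowState`s**: on `Spec ℤ`
with `E = [⊤]` (support `∅`), `ℓ₀ = 1`, one has `∅ ∈ eminusSets` — the shape produced on the instance's own run by
class (A4) (blowing up a whole Cartier member of `E⁻`, whose strict transform is `⊤`). [folklore] -/
theorem not_Eminus_nonempty_all :
    ¬ (∀ (s : RowState.{0}) (Fc : Set (ULift.{1} s.W)), Fc ∈ s.eminusSets → Fc.Nonempty) := by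
  intro h
  let s1 : RowState.{0} :=
    { W := Spec (CommRingCat.of ℤ), ln := inferInstance, I := ⊤, N := ⊤, E := [⊤], ℓ₀ := 1,
      ℓ₀_le := le_rfl, after9 := False }
  have hmem : (∅ : Set (ULift.{1} s1.W)) ∈ s1.eminusSets := by
    refine ⟨⊤, ?_, ?_⟩
    · show (⊤ : s1.W.IdealSheafData) ∈ ([⊤] : List s1.W.IdealSheafData).take 1
      exact List.mem_singleton.2 rfl
    · ext q; simp [RowState.liftSupport, Scheme.IdealSheafData.support_top]
  exact Set.not_nonempty_empty (h s1 ∅ hmem)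

end Summit.ResolutionOfSingularities.ResolutionOfSingularities.Theorems.SigmaMaxModifications.Negative.RowStateLawsUnrelativised
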